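import Summits.HubbardSuperconductivity.HubbardSuperconductivity.Theses.InfiniteVolumeFirst
import Literature.MathematicalPhysics.QuantumLattice.HubbardTorusBlochCurrentBound
import Literature.MathematicalPhysics.QuantumLattice.HubbardTorusFlux

/-!
# Ideator-1 sketch — crux `NoInfraredPileUp` (stmt-HubbardSuperconductivity-18534), round 1

First lemmas of the two crux ideas filed by planner-cruxidea-stmt-HubbardSuperconductivity-18534-1-0:

* §A `bloch-vise-superfluid-fraction` — the pair-reflection current identity (kinematics of
  nearest-neighbour hopping), the bridge `SlidingCarriesCurrent` (superfluid fraction > 1/2 of a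
  hypothetical sliding condensate), the half-flux floor, and the target `NoAsymmetricSliding`
  (no winding-type sliding at the two-quantum boost momentum), closed by the TREE's Bloch theorem
  `bloch_abs_current_le_of_isGroundStateInSector`.
* §B `phonon-equipartition-compressibility` — the Feynman–Onsager bound FROM AN ENERGY FLOOR
  (finite-dimensional, provable now), the density Fourier mode, the hypotheses
  `BoundedDensitySusceptibility` (energy-floor form) and `PhononEquipartition` (bridge), and the
  target `NoSymmetricPileUp`.

Everything is stated over existing declarations; proofs are `sorry` (sketch). Nothing here is an item.
-/

namespace Summit.HubbardSuperconductivity.HubbardSuperconductivity.Cruxes.NoInfraredPileUp.Ideator1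

open Summit.HubbardSuperconductivity.HubbardSuperconductivity.Theses.InfiniteVolumeFirst
open Literature.MathematicalPhysics.QuantumLattice Literature.Probability.LatticeModels Matrix Finset Filter
open scoped ComplexConjugate

noncomputable section

variable (L : ℕ) [NeZero L]

/-! ### Common bookkeeping: the admissible ground-state families of the crux -/

/-- The admissibility clause of `NoInfraredPileUp` (verbatim). -/
def Admissible (U δ : ℝ) (N : ℕ → ℕ) (ψ : ∀ L, Fock (Orb (FermionTorus 2 L))) : Prop :=
  ∀ L, Even L → N L = 2 * ⌊(1 - δ) * (L : ℝ) ^ 2 / 2⌋₊ ∧ star (ψ L) ⬝ᵥ ψ L = 1 ∧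
    IsGroundStateInSector (hubbardTorus 2 L 1 U) (N L) 0 (ψ L)

/-! ### §A  Bloch vise -/

/-- `K₁(φ) = Σ_{x,σ} Re⟨φ, c†_{x+e₁,σ} c_{x,σ} φ⟩` — the `e₁`-hopping sum of the tree's Bloch file
(half the `e₁`-kinetic energy in units `t = 1`). -/
def xHopRe (φ : Fock (Orb (FermionTorus 2 L))) : ℝ :=
  ∑ x : TorusSite 2 L, ∑ σ : Fin 2,
    (star φ ⬝ᵥ ((creation (orb (FermionTorus.ofTorusSite
        (Literature.MathematicalPhysics.QuantumFieldTheory.Site.shift x 0)) σ) *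
      annihilation (orb (FermionTorus.ofTorusSite x) σ)) *ᵥ φ)).re

/-- `J̃₁(φ) = Σ_{x,σ} Im⟨φ, c†_{x+e₁,σ} c_{x,σ} φ⟩` — the `e₁`-current sum of the tree's Bloch file. -/
def xHopIm (φ : Fock (Orb (FermionTorus 2 L))) : ℝ :=
  ∑ x : TorusSite 2 L, ∑ σ : Fin 2,
    (star φ ⬝ᵥ ((creation (orb (FermionTorus.ofTorusSite
        (Literature.MathematicalPhysics.QuantumFieldTheory.Site.shift x 0)) σ) *
      annihilation (orb (FermionTorus.ofTorusSite x) σ)) *ᵥ φ)).im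

/-- Unnormalised fermion Fourier mode `c_σ(k) = Σ_x conj χ_k(x) • c_{x,σ}` (same convention as
`pairFieldAt`). -/
def momentumMode (k : TorusSite 2 L) (σ : Fin 2) :
    Matrix (Finset (Orb (FermionTorus 2 L))) (Finset (Orb (FermionTorus 2 L))) ℂ :=
  ∑ x : TorusSite 2 L, conj (torusChar k x) • annihilation (orb (FermionTorus.ofTorusSite x) σ)

/-- Momentum occupation `n_σ(k) = ‖c_σ(k) ψ‖² / L²` (so `Σ_k n_σ(k) = N_σ`). -/
def momentumOccupation (ψ : Fock (Orb (FermionTorus 2 L))) (k : TorusSite 2 L) (σ : Fin 2) : ℝ :=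
  (star (momentumMode L k σ *ᵥ ψ) ⬝ᵥ (momentumMode L k σ *ᵥ ψ)).re / (L : ℝ) ^ 2

/-- **FIRST LEMMA of card `bloch-vise-superfluid-fraction` (kinematic, provable now).**
PAIR-REFLECTION CURRENT IDENTITY: if the momentum distribution of `ψ` is reflection-symmetric about
HALF a pair momentum `q`, `n_↓(k) = n_↑(q − k)` for all `k` (the state "lives in the frame of a
condensate at pair momentum q"), then its `e₁`-current is `tan(q₁/2)` times its `e₁`-hopping sum:
`|J̃₁(ψ)| = |tan(π q₁-label / L)| · |K₁(ψ)|` — for nearest-neighbour hopping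
`sin k₁ + sin(q₁ − k₁) = 2 sin(q₁/2) cos(k₁ − q₁/2)` and `cos k₁ + cos(q₁ − k₁) = 2 cos(q₁/2) cos(k₁ − q₁/2)`
term by term (exact for the pure `t' = 0` model; `K₁ = Σ_k cos k₁ n(k)`, `J̃₁ = ∓Σ_k sin k₁ n(k)` by
Plancherel). For `q₁`-label `2` (one Lieb–Schultz–Mattis boost unit) this is TWICE Bloch's cap
`tan(π/L) K₁`. [folklore] -/
theorem abs_xHopIm_eq_of_pairReflection (ψ : Fock (Orb (FermionTorus 2 L))) (q : TorusSite 2 L)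
    (hsym : ∀ k : TorusSite 2 L, momentumOccupation L ψ k 1 = momentumOccupation L ψ (q - k) 0) :
    |xHopIm L ψ| = |Real.tan (Real.pi * ((q 0).val : ℝ) / L)| * |xHopRe L ψ| := by
  sorry

/-- **BRIDGE (the physics stub of card `bloch-vise-superfluid-fraction`): A SLIDING CONDENSATE
CARRIES MORE THAN HALF THE RIGID CURRENT.** At weak coupling, for every admissible ground-state
family and every `a > 0`, eventually in even `L`: if a ground state `ψ_L` has `d`-wave pair weight
ASYMMETRICALLY piled at the two-quantum boost momentum `m = (2,0)` (pair momentum `4π/L ê₁`),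
`S_ψ(m) − S_ψ(−m) ≥ a L²`, then its `e₁`-current exceeds `(1/2 + c)` of the condensate-frame value
`tan(2π/L) K₁` and `K₁ > 0`. Physically: superfluid fraction `D_s/⟨−k_x⟩ > 1/2`; the clean weak-coupling
truth is `≈ 1` (London limit, Scalapino–White–Zhang 1993 §II; Leggett). Fails exactly for
"backflow" states (condensate at `4π/L` plus `≳ L` depaired quasiparticles), which cost a DIVERGENT
energy `≳ √(LΔ)` above the un-backflowed state — not an `O(1)` witness. -/
def SlidingCarriesCurrent : Prop :=
  ∀ δ ∈ Set.Ioo (0:ℝ) (1 / 2), ∃ U₁ : ℝ, 0 < U₁ ∧ ∃ c : ℝ, 0 < c ∧ ∀ U ∈ Set.Ioo (0:ℝ) U₁,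
    ∀ (N : ℕ → ℕ) (ψ : ∀ L, Fock (Orb (FermionTorus 2 L))), Admissible U δ N ψ →
      ∀ a : ℝ, 0 < a → ∃ L₀ : ℕ, ∀ (L : ℕ) [NeZero L], Even L → L₀ ≤ L →
        ∀ m : TorusSite 2 L, m 0 = 2 → m 1 = 0 →
          a * (L : ℝ) ^ 2 ≤ pairStructureFactor dWaveFormFactor L (ψ L) m -
              pairStructureFactor dWaveFormFactor L (ψ L) (-m) →
            (1 / 2 + c) * Real.tan (2 * Real.pi / L) * xHopRe L (ψ L) ≤ |xHopIm L (ψ L)| ∧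
              0 < xHopRe L (ψ L)

/-- TARGET OF §A: NO ASYMMETRIC (winding-type, Fulde–Ferrell-like) SLIDING at the two-quantum boost
momentum — the exact class of the `WallSoft.lean` witnesses `G_{±1}ψ₀`. -/
def NoAsymmetricSliding : Prop :=
  ∀ δ ∈ Set.Ioo (0:ℝ) (1 / 2), ∃ U₁ : ℝ, 0 < U₁ ∧ ∀ U ∈ Set.Ioo (0:ℝ) U₁,
    ∀ (N : ℕ → ℕ) (ψ : ∀ L, Fock (Orb (FermionTorus 2 L))), Admissible U δ N ψ →
      ∀ a : ℝ, 0 < a → ∃ L₀ : ℕ, ∀ (L : ℕ) [NeZero L], Even L → L₀ ≤ L →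
        ∀ m : TorusSite 2 L, m 0 = 2 → m 1 = 0 →
          pairStructureFactor dWaveFormFactor L (ψ L) m -
              pairStructureFactor dWaveFormFactor L (ψ L) (-m) < a * (L : ℝ) ^ 2

/-- Trig threshold for the Bloch vise: for `c > 0` and all large `L`,
`1 − cos(2Real.pi/L) < sin(2Real.pi/L) · ((1/2 + c) · tan(2Real.pi/L))`. -/
theorem vise_trig_threshold (c : ℝ) (hc : 0 < c) :
    ∃ L₁ : ℕ, ∀ L : ℕ, L₁ ≤ L →
      1 - Real.cos (2 * Real.pi / L) < Real.sin (2 * Real.pi / L) * ((1 / 2 + c) * Real.tan (2 * Real.pi / L)) := by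
  obtain ⟨L₁, hL₁⟩ : ∃ L₁ : ℕ, (5 : ℝ) ≤ L₁ ∧ Real.pi * Real.sqrt ((1 + 2 * c) / (2 * c)) < L₁ := by
    obtain ⟨n, hn⟩ := exists_nat_gt (max (5 : ℝ) (Real.pi * Real.sqrt ((1 + 2 * c) / (2 * c))))
    exact ⟨n, le_of_lt (lt_of_le_of_lt (le_max_left _ _) hn), lt_of_le_of_lt (le_max_right _ _) hn⟩
  refine ⟨L₁, fun L hL => ?_⟩
  have hL5 : (5 : ℝ) ≤ L := hL₁.1.trans (by exact_mod_cast hL)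
  have hLpos : (0 : ℝ) < L := by linarith
  set x : ℝ := Real.pi / L with hxdef
  have h2x : 2 * Real.pi / L = 2 * x := by rw [hxdef]; ring
  have hxpos : 0 < x := div_pos Real.pi_pos hLpos
  have hxle : x ≤ Real.pi / 5 := by
    rw [hxdef]; exact div_le_div_of_nonneg_left Real.pi_pos.le (by norm_num) hL5
  have hxlt1 : x < 1 := by
    have : Real.pi / 5 < 1 := by
      have := Real.pi_lt_d2  -- Real.pi < 3.15
      linarith
    linarith
  have h2xlt : 2 * x < Real.pi / 2 := by
    have := Real.pi_pos
    linarith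
  -- basic signs
  have hsinx : 0 < Real.sin x := Real.sin_pos_of_pos_of_lt_pi hxpos (by linarith [Real.pi_pos])
  have hcos2 : 0 < Real.cos (2 * x) :=
    Real.cos_pos_of_mem_Ioo ⟨by linarith, h2xlt⟩
  have hcos2le : Real.cos (2 * x) ≤ 1 := Real.cos_le_one _
  have hcosx : 1 - x ^ 2 / 2 ≤ Real.cos x := Real.one_sub_sq_div_two_le_cos
  have hcosx0 : 0 ≤ 1 - x ^ 2 / 2 := by nlinarith
  -- x² < 2c/(1+2c)
  have hx2 : x ^ 2 * (1 + 2 * c) < 2 * c := by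
    have hLgt : Real.pi * Real.sqrt ((1 + 2 * c) / (2 * c)) < L := hL₁.2.trans_le (by exact_mod_cast hL)
    have hs : Real.sqrt ((1 + 2 * c) / (2 * c)) < L / Real.pi := by
      rw [lt_div_iff₀ Real.pi_pos]; linarith
    have hs0 : 0 ≤ Real.sqrt ((1 + 2 * c) / (2 * c)) := Real.sqrt_nonneg _
    have hsq : (1 + 2 * c) / (2 * c) < (L / Real.pi) ^ 2 := by
      have := Real.sq_sqrt (show 0 ≤ (1 + 2 * c) / (2 * c) by positivity)
      nlinarith
    have hxinv : x = (L / Real.pi)⁻¹ := by rw [hxdef, inv_div]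
    rw [hxinv, inv_pow]
    have hLp : 0 < (L / Real.pi) ^ 2 := by positivity
    rw [div_lt_iff₀ (by positivity)] at hsq
    rw [inv_mul_eq_div, div_lt_iff₀ hLp]
    linarith
  -- (1+2c) cos² x > 1
  have hkey : 1 < (1 + 2 * c) * Real.cos x ^ 2 := by
    have h1 : (1 - x ^ 2 / 2) ^ 2 ≤ Real.cos x ^ 2 := by
      exact pow_le_pow_left₀ hcosx0 hcosx 2
    have h2 : 1 - x ^ 2 ≤ (1 - x ^ 2 / 2) ^ 2 := by nlinarith
    nlinarith
  -- rewrite both sides in terms of x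
  rw [h2x, Real.tan_eq_sin_div_cos]
  have hL : 1 - Real.cos (2 * x) = 2 * Real.sin x ^ 2 := by
    rw [Real.cos_two_mul, Real.cos_sq']; ring
  have hS : Real.sin (2 * x) = 2 * Real.sin x * Real.cos x := Real.sin_two_mul x
  -- RHS ≥ (1/2 + c) sin²(2x)
  have hR : (1 / 2 + c) * Real.sin (2 * x) ^ 2 ≤
      Real.sin (2 * x) * ((1 / 2 + c) * (Real.sin (2 * x) / Real.cos (2 * x))) := by
    rw [show Real.sin (2 * x) * ((1 / 2 + c) * (Real.sin (2 * x) / Real.cos (2 * x))) =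
      (1 / 2 + c) * Real.sin (2 * x) ^ 2 / Real.cos (2 * x) by field_simp]
    rw [le_div_iff₀ hcos2]
    have : 0 ≤ (1 / 2 + c) * Real.sin (2 * x) ^ 2 := by positivity
    nlinarith
  have hmid : 2 * Real.sin x ^ 2 < (1 / 2 + c) * Real.sin (2 * x) ^ 2 := by
    rw [hS]
    have hs2 : 0 < Real.sin x ^ 2 := by positivity
    nlinarith
  linarith

/-- Bloch's theorem (tree) in the notation `xHopIm`/`xHopRe`: a normalised sector ground state has
`|sin(2π/L)·2J̃₁| ≤ (1 − cos(2π/L))·2K₁`. [cite: Bohm1949, Bloch's theorem] -/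
theorem bloch_xHop (hL : 3 ≤ L) (U : ℝ) (N : ℕ) (M : ℝ) (φ : Fock (Orb (FermionTorus 2 L)))
    (hgs : IsGroundStateInSector (hubbardTorus 2 L 1 U) N M φ) (h1 : star φ ⬝ᵥ φ = 1) :
    |Real.sin (2 * Real.pi / L) * (2 * xHopIm L φ)| ≤
      (1 - Real.cos (2 * Real.pi / L)) * (2 * xHopRe L φ) :=
  bloch_abs_current_le_of_isGroundStateInSector hL U N M φ hgs h1

/-- **THE VISE CLOSES (proved here from the bridge + the tree's Bloch theorem + trigonometry).**
`bloch_abs_current_le_of_isGroundStateInSector` caps every sector ground state's current at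
`|sin(2π/L) J̃₁| ≤ (1 − cos(2π/L)) K₁`, i.e. `|J̃₁| ≤ tan(π/L) K₁`; the bridge gives
`|J̃₁| ≥ (1/2 + c) tan(2π/L) K₁` with `K₁ > 0`; and `(1/2 + c) tan(2π/L) > tan(π/L)` as soon as
`cos²(π/L) > 1/(1+2c)` (`vise_trig_threshold`). [folklore] -/
theorem noAsymmetricSliding_of_slidingCarriesCurrent (h : SlidingCarriesCurrent) :
    NoAsymmetricSliding := by
  intro δ hδ
  obtain ⟨U₁, hU₁, c, hc, hmain⟩ := h δ hδ
  refine ⟨U₁, hU₁, fun U hU N ψ hadm a ha => ?_⟩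
  obtain ⟨L₀, hL₀⟩ := hmain U hU N ψ hadm a ha
  obtain ⟨L₁, hL₁⟩ := vise_trig_threshold c hc
  refine ⟨L₀ + L₁ + 3, fun L _ hE hL => ?_⟩
  intro m hm0 hm1
  by_contra hge
  push_neg at hge
  obtain ⟨hJ, hK⟩ := hL₀ L hE (by omega) m hm0 hm1 hge
  have hB := bloch_xHop L (by omega) U (N L) 0 (ψ L) (hadm L hE).2.2 (hadm L hE).2.1
  have ht := hL₁ L (by omega)
  -- positivity of sin (2π/L)
  have hLr : (3 : ℝ) ≤ L := by exact_mod_cast (show 3 ≤ L by omega)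
  have hs : 0 < Real.sin (2 * Real.pi / L) := by
    apply Real.sin_pos_of_pos_of_lt_pi
    · positivity
    · rw [div_lt_iff₀ (by linarith)]; nlinarith [Real.pi_pos]
  -- |sin·2J| = 2 sin |J|
  have habs : |Real.sin (2 * Real.pi / L) * (2 * xHopIm L (ψ L))| =
      2 * Real.sin (2 * Real.pi / L) * |xHopIm L (ψ L)| := by
    rw [abs_mul, abs_mul, abs_of_pos hs, abs_of_pos (by norm_num : (0:ℝ) < 2)]; ring
  rw [habs] at hB
  -- chain: 2 sin (1/2+c) tan K ≤ 2 sin |J| ≤ (1-cos) 2K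
  have h1 : 2 * Real.sin (2 * Real.pi / L) * ((1 / 2 + c) * Real.tan (2 * Real.pi / L) * xHopRe L (ψ L))
      ≤ 2 * Real.sin (2 * Real.pi / L) * |xHopIm L (ψ L)| :=
    mul_le_mul_of_nonneg_left hJ (by positivity)
  have h2 : 2 * Real.sin (2 * Real.pi / L) * ((1 / 2 + c) * Real.tan (2 * Real.pi / L) * xHopRe L (ψ L))
      ≤ (1 - Real.cos (2 * Real.pi / L)) * (2 * xHopRe L (ψ L)) := h1.trans hB
  have h3 : Real.sin (2 * Real.pi / L) * ((1 / 2 + c) * Real.tan (2 * Real.pi / L)) * xHopRe L (ψ L)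
      ≤ (1 - Real.cos (2 * Real.pi / L)) * xHopRe L (ψ L) := by nlinarith
  have h4 : Real.sin (2 * Real.pi / L) * ((1 / 2 + c) * Real.tan (2 * Real.pi / L))
      ≤ 1 - Real.cos (2 * Real.pi / L) := le_of_mul_le_mul_right h3 hK
  linarith

/-- HALF-FLUX FLOOR (Byers–Yang `hc/2e` periodicity, energy-only; needed only for the ONE-quantum
modes `|m|_∞ = 1`, which a single LSM boost cannot unwind): at weak coupling the antiperiodic torus
does not undercut the periodic one by `O(1)` — `E_L(U,δ;π) ≥ E_L(U,δ;0) − γ` eventually, for every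
`γ > 0` (`fluxEnergy` = the sector minimum of `hubbardTorusFlux`, the Byers–Yang envelope of route
FluxSpectroscopy). False at `U = 0` on open shells by `O(1)` (paramagnetic rows); quenched once
`L ≫ v_F/Δ`. -/
def HalfFluxFloor : Prop :=
  ∀ δ ∈ Set.Ioo (0:ℝ) (1 / 2), ∃ U₁ : ℝ, 0 < U₁ ∧ ∀ U ∈ Set.Ioo (0:ℝ) U₁, ∀ γ : ℝ, 0 < γ →
    ∃ L₀ : ℕ, ∀ (L : ℕ) [NeZero L], Even L → L₀ ≤ L →
      fluxEnergy L U δ 0 - γ ≤ fluxEnergy L U δ Real.pi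

/-- INCOHERENT REMAINDER (cost control for the mode filter `n_m = L⁻² Δ_d(m)ᴴ Δ_d(m)` on the
exceptional sides where the `±` boosted momentum sectors coincide): removing a pair from a ground
state at the piled-up momentum lands, up to an `O(L)`-norm remainder, on an eigenvector —
`‖(H − (E₀ − ν)) Δ_d(m) ψ‖² ≤ C L²` for some real `ν` (second moment of the pair-removal spectral
measure about its centre is `O(L²)`, i.e. `[H,P_x] + νP_x` has no long-range order). Holds for BCS and
for the free Fermi sea (`I_L ≈ 7`, TRIAGE-r2-2 of crux 1089); used only as a COST bound. -/
def IncoherentRemainder : Prop :=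
  ∀ δ ∈ Set.Ioo (0:ℝ) (1 / 2), ∃ U₁ : ℝ, 0 < U₁ ∧ ∃ C : ℝ, ∀ U ∈ Set.Ioo (0:ℝ) U₁,
    ∀ (N : ℕ → ℕ) (ψ : ∀ L, Fock (Orb (FermionTorus 2 L))), Admissible U δ N ψ →
      ∃ L₀ : ℕ, ∀ (L : ℕ) [NeZero L], Even L → L₀ ≤ L → ∀ m : TorusSite 2 L, ∃ ν : ℝ,
        (star ((hubbardTorus 2 L 1 U -
            (((hubbardTorus 2 L 1 U).minEnergyOn (szSector (Λ := FermionTorus 2 L) (N L) 0) - ν : ℝ) : ℂ) •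
              (1 : Matrix _ _ ℂ)) *ᵥ (pairFieldAt dWaveFormFactor L m *ᵥ ψ L)) ⬝ᵥ
          ((hubbardTorus 2 L 1 U -
            (((hubbardTorus 2 L 1 U).minEnergyOn (szSector (Λ := FermionTorus 2 L) (N L) 0) - ν : ℝ) : ℂ) •
              (1 : Matrix _ _ ℂ)) *ᵥ (pairFieldAt dWaveFormFactor L m *ᵥ ψ L))).re ≤ C * (L : ℝ) ^ 2

/-! ### §B  Feynman–Onsager from an energy floor (density channel) -/

/-- **FIRST LEMMA of card `phonon-equipartition-compressibility` (finite-dimensional, provable now).**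
FEYNMAN–ONSAGER FROM AN ENERGY FLOOR: let `ψ` be a unit vector of an `H`- and `V`-invariant subspace
`K` that is an eigenvector at the sector energy `minEnergyOn H K` (`IsGroundStateInSector`), with `⟨ψ,Vψ⟩ = 0` and `⟨Vψ, V² ψ⟩ = 0` (both automatic for a
momentum eigenstate and `V = ρ(q) + ρ(q)ᴴ`, `3q ≠ 0`). If the perturbed sector energy has the
quadratic floor `E₀(H + hV) ≥ E₀(H) − C h²` for `|h| ≤ h₀`, then
`⟨Vψ,Vψ⟩² ≤ C · Re⟨Vψ, (H − E₀) Vψ⟩` — fluctuation² ≤ susceptibility-floor × f-sum. Proof: trial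
vectors `ψ − s h • Vψ`, Rayleigh quotient `E₀ + h²(s² m₁ − 2 s m₀)/(1 + s²h²m₀)`, floor, `h → 0`,
optimise `s = m₀/m₁`. Pitaevskii–Stringari, J. Low Temp. Phys. 85 (1991) 377 (moments
`m₀² ≤ m₁ m₋₁`); Feynman (1954). [folklore] -/
theorem fluct_sq_le_floor_mul_fsum {n : Type*} [Fintype n] [DecidableEq n]
    (H V : Matrix n n ℂ) (hH : H.IsHermitian) (hV : V.IsHermitian) (K : Submodule ℂ (n → ℂ))
    (hHK : ∀ v ∈ K, H *ᵥ v ∈ K) (hVK : ∀ v ∈ K, V *ᵥ v ∈ K)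
    (ψ : n → ℂ) (hψ : ψ ∈ K) (h1 : star ψ ⬝ᵥ ψ = 1)
    (hev : H *ᵥ ψ = ((H.minEnergyOn K : ℝ) : ℂ) • ψ)
    (h0 : star ψ ⬝ᵥ (V *ᵥ ψ) = 0) (h3 : star (V *ᵥ ψ) ⬝ᵥ (V *ᵥ (V *ᵥ ψ)) = 0)
    (C h₀ : ℝ) (hh₀ : 0 < h₀)
    (hfloor : ∀ h : ℝ, |h| ≤ h₀ → H.minEnergyOn K - C * h ^ 2 ≤ (H + (h : ℂ) • V).minEnergyOn K) :
    ((star (V *ᵥ ψ) ⬝ᵥ (V *ᵥ ψ)).re) ^ 2 ≤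
      C * (star (V *ᵥ ψ) ⬝ᵥ ((H - ((H.minEnergyOn K : ℝ) : ℂ) • (1 : Matrix n n ℂ)) *ᵥ (V *ᵥ ψ))).re := by
  sorry

/-- The density Fourier mode `ρ(q) = Σ_x conj χ_q(x) • (n_{x↑} + n_{x↓})` (unnormalised). -/
def densityMode (q : TorusSite 2 L) :
    Matrix (Finset (Orb (FermionTorus 2 L))) (Finset (Orb (FermionTorus 2 L))) ℂ :=
  ∑ x : TorusSite 2 L, conj (torusChar q x) •
    (numberOp (FermionTorus.ofTorusSite x) 0 + numberOp (FermionTorus.ofTorusSite x) 1)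

/-- The Hermitian density wave `V_q = ρ(q) + ρ(q)ᴴ = 2 Σ_x cos(q·x) n_x`. -/
def densityWave (q : TorusSite 2 L) :
    Matrix (Finset (Orb (FermionTorus 2 L))) (Finset (Orb (FermionTorus 2 L))) ℂ :=
  densityMode L q + (densityMode L q)ᴴ

/-- HYPOTHESIS B1 — BOUNDED LONG-WAVELENGTH DENSITY SUSCEPTIBILITY (energy-floor form; "no incipient
phase separation" at weak coupling): there is `χ` such that, eventually in even `L`, for every small
nonzero `q` and `|h| ≤ h₀`, the sector ground energy of `H − h V_q` is `≥ E₀ − χ h² L²`. An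
energy-DENSITY-level statement for a wavelength-`L` potential (LDA + finite compressibility
`κ = ∂n/∂μ`), not an `O(1)`-resolution one; free value `χ₀ = N(0)/2 < ∞` for `δ ∈ (0,1/2)`;
repulsion lowers it (RPA). Its failure IS phase separation — the crux's own named refutation surface. -/
def BoundedDensitySusceptibility : Prop :=
  ∀ δ ∈ Set.Ioo (0:ℝ) (1 / 2), ∃ U₁ : ℝ, 0 < U₁ ∧ ∀ U ∈ Set.Ioo (0:ℝ) U₁,
    ∃ χ : ℝ, ∃ h₀ : ℝ, 0 < h₀ ∧ ∃ ε₀ : ℝ, 0 < ε₀ ∧ ∃ L₀ : ℕ, ∀ (L : ℕ) [NeZero L], Even L → L₀ ≤ L →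
      ∀ q : TorusSite 2 L, q ≠ 0 → momentumNormSq L q ≤ ε₀ ^ 2 → ∀ h : ℝ, |h| ≤ h₀ →
        (hubbardTorus 2 L 1 U).minEnergyOn
            (szSector (Λ := FermionTorus 2 L) (2 * ⌊(1 - δ) * (L : ℝ) ^ 2 / 2⌋₊) 0) - χ * h ^ 2 * (L : ℝ) ^ 2 ≤
          (hubbardTorus 2 L 1 U + (h : ℂ) • densityWave L q).minEnergyOn
            (szSector (Λ := FermionTorus 2 L) (2 * ⌊(1 - δ) * (L : ℝ) ^ 2 / 2⌋₊) 0)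

/-- HYPOTHESIS B2 — PHONON EQUIPARTITION (the bridge of card `phonon-equipartition-compressibility`):
in an exact ground state, `d`-wave pair weight piled up SYMMETRICALLY across the window (no single
asymmetric winding mode — the complement of §A's class) with a depleted zero mode is accompanied by
an anomalous, `Θ(L²)`, density fluctuation at some window momentum: the stationary-state
equipartition `⟨|δn_q|²⟩/κ = ρ_s q² ⟨|θ_q|²⟩` of the phase–density mode, read through the exact
identity `⟨ψ,[H, Δ_d(0)ᴴ Δ_d(q) ρ(−q)] ψ⟩ = 0`. -/
def PhononEquipartition : Prop :=
  ∀ δ ∈ Set.Ioo (0:ℝ) (1 / 2), ∃ U₁ : ℝ, 0 < U₁ ∧ ∀ U ∈ Set.Ioo (0:ℝ) U₁,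
    ∀ (N : ℕ → ℕ) (ψ : ∀ L, Fock (Orb (FermionTorus 2 L))), Admissible U δ N ψ →
      ∀ η : ℝ, 0 < η → ∃ b : ℝ, 0 < b ∧ ∃ θ : ℝ, 0 < θ ∧ ∀ ε : ℝ, 0 < ε → ∃ L₀ : ℕ,
        ∀ (L : ℕ) [NeZero L], Even L → L₀ ≤ L →
          -- symmetric, zero-mode-depleted pile-up of weight ≥ ηL² in the window …
          η * (L : ℝ) ^ 2 ≤ (∑ m : TorusSite 2 L, if m ≠ 0 ∧ momentumNormSq L m ≤ ε ^ 2 then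
              pairStructureFactor dWaveFormFactor L (ψ L) m else 0) →
          pairStructureFactor dWaveFormFactor L (ψ L) 0 ≤ θ * (L : ℝ) ^ 2 →
          (∀ m : TorusSite 2 L, |pairStructureFactor dWaveFormFactor L (ψ L) m -
              pairStructureFactor dWaveFormFactor L (ψ L) (-m)| ≤ θ * (L : ℝ) ^ 2) →
          -- no WINDING component: the mode-filtered fragments `Δ_d(m)ᴴ Δ_d(m) ψ` carry no
          -- macroscopic `e₁`-current (and the `e₂` analogue) — this is what separates phase
          -- PHONONS from the Lieb–Schultz–Mattis winding cats of §A on the exceptional sides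
          (∀ m : TorusSite 2 L,
            |xHopIm L ((pairFieldAt dWaveFormFactor L m)ᴴ *ᵥ (pairFieldAt dWaveFormFactor L m *ᵥ ψ L))| ≤
              θ * (L : ℝ) * (star ((pairFieldAt dWaveFormFactor L m)ᴴ *ᵥ (pairFieldAt dWaveFormFactor L m *ᵥ ψ L)) ⬝ᵥ
                ((pairFieldAt dWaveFormFactor L m)ᴴ *ᵥ (pairFieldAt dWaveFormFactor L m *ᵥ ψ L))).re) →
          -- … forces a macroscopic density fluctuation at some window momentum
          ∃ q : TorusSite 2 L, q ≠ 0 ∧ momentumNormSq L q ≤ ε ^ 2 ∧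
            b * (L : ℝ) ^ 2 ≤ (star (densityWave L q *ᵥ ψ L) ⬝ᵥ (densityWave L q *ᵥ ψ L)).re

/-- TARGET OF §B: NO SYMMETRIC (phonon / fragmented) PILE-UP with a depleted zero mode. -/
def NoSymmetricPileUp : Prop :=
  ∀ δ ∈ Set.Ioo (0:ℝ) (1 / 2), ∃ U₁ : ℝ, 0 < U₁ ∧ ∀ U ∈ Set.Ioo (0:ℝ) U₁,
    ∀ (N : ℕ → ℕ) (ψ : ∀ L, Fock (Orb (FermionTorus 2 L))), Admissible U δ N ψ →
      ∀ η : ℝ, 0 < η → ∃ θ : ℝ, 0 < θ ∧ ∃ ε : ℝ, 0 < ε ∧ ∃ L₀ : ℕ, ∀ (L : ℕ) [NeZero L],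
        Even L → L₀ ≤ L →
          pairStructureFactor dWaveFormFactor L (ψ L) 0 ≤ θ * (L : ℝ) ^ 2 →
          (∀ m : TorusSite 2 L, |pairStructureFactor dWaveFormFactor L (ψ L) m -
              pairStructureFactor dWaveFormFactor L (ψ L) (-m)| ≤ θ * (L : ℝ) ^ 2) →
          (∀ m : TorusSite 2 L,
            |xHopIm L ((pairFieldAt dWaveFormFactor L m)ᴴ *ᵥ (pairFieldAt dWaveFormFactor L m *ᵥ ψ L))| ≤
              θ * (L : ℝ) * (star ((pairFieldAt dWaveFormFactor L m)ᴴ *ᵥ (pairFieldAt dWaveFormFactor L m *ᵥ ψ L)) ⬝ᵥ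
                ((pairFieldAt dWaveFormFactor L m)ᴴ *ᵥ (pairFieldAt dWaveFormFactor L m *ᵥ ψ L))).re) →
          (∑ m : TorusSite 2 L, if m ≠ 0 ∧ momentumNormSq L m ≤ ε ^ 2 then
              pairStructureFactor dWaveFormFactor L (ψ L) m else 0) ≤ η * (L : ℝ) ^ 2

/-- **§B CLOSES modulo the f-sum bound (provable now: `Re⟨V_qψ,(H−E₀)V_qψ⟩ = ½⟨[V_q,[H,V_q]]⟩ ≤
8·momentumNormSq·(kinetic) ≤ C'|q|²L²`, translation bookkeeping `⟨ψ,V_qψ⟩ = 0`, `⟨V_qψ,V_q²ψ⟩ = 0`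
for momentum-eigenstate ground states).** B1 + `fluct_sq_le_floor_mul_fsum` give
`⟨V_qψ,V_qψ⟩ ≤ √(χ C') |q| L² ≤ √(χC') ε L²`, contradicting B2's `b L²` once `ε < b/√(χC')`. -/
theorem noSymmetricPileUp_of (hB1 : BoundedDensitySusceptibility) (hB2 : PhononEquipartition) :
    NoSymmetricPileUp := by
  sorry

end

end Summit.HubbardSuperconductivity.HubbardSuperconductivity.Cruxes.NoInfraredPileUp.Ideator1
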